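/-
Copyright (c) 2026 the pub-hodgecm-mathlib formalisation cell (harness21).  Track B «K2-LIT» prover seat hodgecm-mathlib-K2E5-p07 (g3) (cross-unit hand on E3's BONUS road (d-w)
of ‹J3› v2, road owner K2E3-p03 (g3); dealer K2E3-plan (g3) deal (D50) 2026-09-04T03:38:10Z): THE (C2) CLOSER — the wild anisotropic residual count `N_an` from its three parts.
-/
import Summits.HodgeConjecture.HodgeConjecture.Theorems.K2E3WildPlaneTorusCount                      -- ★ (C2a) p857092 (K2E5-p16 (g3)): `relIndex_normOne_depth_four_mul_eq_of_even∕_of_odd`, `valued_four_eq`; brings ★ LH4-p02 `exists_subgroup_normOne(_depth)`, ★ `valued_toPlace_eq_sq_of_ramified`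
import Literature.NumberTheory.Weil1982.UnitaryFinTopFormLieGramWildLieSide                          -- ★ p857013: the (C2) cand's `levelOf … (ballMat L 2 v resChar)` currency (brings ★ R3a-1, ★ `UnitaryFinCayleyWindow`, `localNonsplitEquiv`)
import Literature.NumberTheory.Weil1982.UnitaryFinTopFormUnimodularLieLattice                        -- ★ (HS-A): `levelOf_ballMat_le_inf_level` (`K(4) ≤ Z(1) ⊓ K_an`)
import Literature.NumberTheory.Automorphic.RamifiedPlaceDifferent                                    -- ★ p850872: `exists_different_of_ramified` (the different number `d` and the √π ∕ √u dictionary), `valued_galAdicCompletionMap_sub_self_ne_zero`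
import Literature.NumberTheory.LocalFields.RamifiedPlaceAntiFixedUnitParity                          -- ★ p855?: `even_log_valued_of_complexConj_eq_neg_of_unit` (anti-fixed unit ⇒ anti-fixed elements have even order ⇒ `d` even)
import Literature.NumberTheory.Automorphic.RamifiedPlaceBlockWild                                    -- ★ `exists_valued_eq_exp_neg_one` (a uniformiser of `L_w`)
import Literature.NumberTheory.Automorphic.AdelicAdditiveCharacterGaloisTwist                         -- ★ `valued_natCast_lt_one_of_mem` (`2 ∈ v ⇒ |2|_v < 1`)
import Literature.NumberTheory.Automorphic.Liu2021.LemD1AsPrintedIndexedNonVacuityTameSynthesis           -- ★ `isUnramifiedIn_of_ramificationIdx'_eq_one`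
import Literature.NumberTheory.Automorphic.UnitaryGroupIntegralPointsReductionInert                   -- ★ `natCard_residueField_valuativeRel_eq` (`#𝓀[L⁺_v] = #(𝓞 L⁺ ∕ v)`, `ValuativeRel` presentation)
import HarnessLib

/-!
# (C2) «wild anisotropic residual count» ⟸ (C2-struct) ∧ (C2b-i) «top index» ∧ (C2b-ii) «ladder» (+ ★ (C2a) torus): `N_an = [S : S ∩ K_an]·[S ∩ K_an : S ∩ K(4)]·[E¹ : E¹(4)]`

Cell `pub/hodgecm-mathlib`, crux H413 = `stmt-HodgeConjecture-24833` (supports-only, `--as helper`), Track B E3∕E4 junction ‹S›, ROAD J, letter ‹J3› v2 — road (d-w)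
(owner K2E3-p03 (g3)), deal (D50) «(C2) closer» (dealer K2E3-plan (g3) 03:38:10Z).  The chain: ‹J3› v2 ⟸ (J3d-w) ⟸ (W3) ⟸★ p857062 (C-ratio) ⟸★ p857088 {(C1) ★-REL p857122, (C2)}.
THIS FILE reduces the anisotropic count letter **(C2)** `sig_K2E3WildAnisotropicResidualCount` (K2E3-p03 (g3) cand 9baa80069c9b2f15, statement VERBATIM as the conclusion:
`N_an := [U_an : K_an(4)] = 2(q+1)q^{8m−1}` at type √π (`|α|_w = q_w⁻¹` for the anti-fixed type key `α`), `= 2(q+1)q^{8m−2}` at type √u (`|α|_w = 1`), `U_an = U(⟨1,−ξ⟩)(L⁺_v) =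
Z(1)` compact, `K_an(4) =` ★ R3a-1's `levelOf 1 (ballMat resChar)`, `|2|_v = q^{−m}`) to THREE CLOSED LETTERS taken as hypotheses binder for binder:
* `hS` = K2E5-p16 (g3)'s **(C2-struct)** `K2E3WildPlaneAnisoCountStructure.relIndex_levelOf_anisoPlane_eq_mul` (REPORT-FIRST head 03:35:41Z as amended 03:36:47Z, ∀-closed over
  its section frame `(L v w hw)`): `N_an = [S : S ∩ K(4)] · [T : T_n]` for the determinant-one subgroup `S` (membership read in the one-place model ★ `localNonsplitEquiv`) and the
  norm-one torus `T ≥ T_n` of `L_w ∕ L⁺_v` at level `|t − 1|_w ≤ |2·resChar|_w` (hypothesis-characterised subgroups, ★ LH4-p02 currency);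
* `hTop` = **(C2b-i) «TOP INDEX»** (K2E4-p07 (g4), REPORT-FIRST 03:40:10Z, road-owner correction 03:36:02Z), stated here S-RELATIVELY: `[S : S ∩ K_an] = (q+1)·q^{d−2}`, `d` the
  different number of `L_w ∕ L⁺_v` in the (L)-kit binder form `∀ τ, |τ|_w = q_w⁻¹ → |σ_wτ − τ|_w = q_w^{−d}` (= `[D¹ : Λ¹]`, the number of `U_an`-translates of `𝒪_w²`);
* `hLad` = **(C2b-ii) «LADDER»** (K2E4-p14 (g4), road-owner shape 03:36:47Z (2)): `[S ∩ K_an : S ∩ K(4)] = q^{6m−⌊d∕2⌋}` (the norm-one ladder of the order `Λ = 𝒪_w ⊕ 𝒪_w·j`).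
THE PROOF (bookkeeping; the analysis is in the three letters and in ★ (C2a)): `S := ker(det ∘ E_w)`, `T`, `T_n` from ★ `exists_subgroup_normOne(_depth)`; `resChar v = 2` (`2 ∈ v`) so
`|2·resChar|_w = |4|_w = q_w^{−4m}` (★ `valued_four_eq`) and ★ (C2a) reads `[T : T_n] = 2q^m` (√π) ∕ `2q^{2m−k}` (√u, `d = 2k`); the DICTIONARY between the type key `α` of the letter
and the different number `d` is ★ `exists_different_of_ramified` (an anti-fixed UNIFORMISER exists iff `q_w^{−d} = |2|_w·q_w⁻¹`, i.e. `d = 2m+1`; an anti-fixed UNIT exists iff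
`|2|_w·q_w⁻¹ < q_w^{−d}`, i.e. `d ≤ 2m`) + ★ `even_log_valued_of_complexConj_eq_neg_of_unit` (with an anti-fixed unit, the anti-fixed element `σ_wτ − τ ≠ 0` has even order, so
`d = 2k`); then `[S : S ∩ K(4)] = [S ∩ K_an : S ∩ K(4)]·[S : S ∩ K_an]` (Mathlib `Subgroup.relIndex_mul_relIndex`, `K(4) ≤ K_an` ★ (HS-A)) and ℕ-arithmetic
`q^{6m−⌊d∕2⌋}·(q+1)q^{d−2}·2q^{m}= 2(q+1)q^{8m−1}` (d = 2m+1), `q^{6m−k}·(q+1)q^{2k−2}·2q^{2m−k} = 2(q+1)q^{8m−2}` (d = 2k, 1 ≤ k ≤ m).  So after PART C hosts (C2b-i)∕(C2b-ii) (cands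
`K2/K2E5-p07/g3/sig_K2E3WildAnisoTopIndex.cand…`, `…sig_K2E3WildAnisoLadderIndex.cand…` = `hTop`∕`hLad` VERBATIM) and ties (C2) through `anCount_of_struct_of_topIndex_of_ladder`,
‹J3› v2 is ★ modulo {(C1-I), (C2-struct) [p16 typing], (C2b-i) [K2E4-p07 (g4)], (C2b-ii) [K2E4-p14 (g4)]}.
HONEST LABEL: `--supports stmt-HodgeConjecture-24833 --as helper`, count-neutral; (C2) is NOT proved here — it is REDUCED to its three parts; HC_CM is proved only modulo the 7 printed
citations (2 remaining named inputs: hLiu418 = `stmt-HodgeConjecture-24832`, h413 = `stmt-HodgeConjecture-24833`) until rung 0 closes.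

## References
* [Kottwitz1988] R. E. Kottwitz, *Tamagawa numbers*, Ann. of Math. 127 (1988), §1 Thm. 1, §2 Thm. 2 (the place-freeness of the count the (C-ratio) letter expresses).
* [Serre1979] J.-P. Serre, *Local Fields*, GTM 67 (1979), Ch. IV §1 Prop. 4, §2 (the different number `d = ord(στ − τ)`; the √π ∕ √u dichotomy), Ch. V §3 Cor. 3 (norm-one torus ladder).
* [Jacobowitz1962] R. Jacobowitz, *Hermitian forms over local fields*, Amer. J. Math. 84 (1962), §5, §§9–11 (ramified dyadic «R-P» ∕ «R-U» places).
* [PlatonovRapinchuk1994] V. Platonov, A. Rapinchuk, *Algebraic Groups and Number Theory* (1994), §3.3 (congruence subgroups), §5.1.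
-/

set_option autoImplicit false
set_option linter.dupNamespace false

noncomputable section

open NumberField IsDedekindDomain MeasureTheory
open Literature.NumberTheory.Automorphic Literature.NumberTheory.Automorphic.UnitaryGroup Literature.NumberTheory.Rogawski1990
open Literature.NumberTheory.Weil1982.UnitaryFinTopForm
open scoped MatrixGroups Matrix NNReal

namespace Summit.HodgeConjecture.HodgeConjecture.Cruxes.H413.K2E3WildAnisotropicResidualCountOfParts

open Summit.HodgeConjecture.HodgeConjecture.Cruxes.H413

open Set Matrix Literature.NumberTheory.Automorphic.UnitaryGroup Literature.NumberTheory.GaloisRepresentations in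
open scoped NNReal Classical in
/-- **(C2) «WILD ANISOTROPIC RESIDUAL COUNT» FROM (C2-struct), (C2b-i) «TOP INDEX», (C2b-ii) «LADDER» (and ★ (C2a) torus).**  Conclusion = K2E3-p03 (g3)'s letter (C2)
`sig_K2E3WildAnisotropicResidualCount` VERBATIM (`N_an = 2(q+1)q^{8m−1}` at √π, `2(q+1)q^{8m−2}` at √u); hypotheses `hS` = K2E5-p16 (g3)'s (C2-struct) head ∀-closed, `hTop` = (C2b-i)
`[S : S ∩ K_an] = (q+1)q^{d−2}`, `hLad` = (C2b-ii) `[S ∩ K_an : S ∩ K(4)] = q^{6m−⌊d∕2⌋}` (closed letters, this seat's binder texts).  Proof: `S := ker(det ∘ E_w)`, `T ⊇ T_n` ★ LH4-p02,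
`resChar = 2`, `|4|_w = q_w^{−4m}`, the `α ↔ d` dictionary ★ `exists_different_of_ramified` + ★ anti-fixed parity, `[S : S∩K(4)] = [S∩K_an : S∩K(4)]·[S : S∩K_an]`, ★ (C2a), arithmetic.
[cite: Kottwitz1988, §1 Thm. 1, §2 Thm. 2] [cite: Serre1979, Ch. IV §2, Ch. V §3 Cor. 3] [cite: Jacobowitz1962, §§9–11] [cite: PlatonovRapinchuk1994, §3.3] -/
theorem anCount_of_struct_of_topIndex_of_ladder
    (hS :
      ∀ (L : Type) [Field L] [NumberField L] [IsCMField L] (v : HeightOneSpectrum (𝓞 ↥(maximalRealSubfield L)))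
        (w : PlacesOver L v) (hw : IsCMField.complexConj L • w.1 = w.1)
            {ξ : L} (hξ1 : Valued.v (algebraMap L (w.1.adicCompletion L) ξ) = 1)
        (ha : ∀ w' : PlacesOver L v, Valued.v (((resChar L v : ℕ) : LocalRing L v) w') < 1)
        (S : Subgroup ((cmDatum L 2 !![(1 : L), 0; 0, -ξ]).Local v))
        (hS : ∀ g : (cmDatum L 2 !![(1 : L), 0; 0, -ξ]).Local v, g ∈ S ↔
          (((localNonsplitEquiv (IsCMField.complexConj L) !![(1 : L), 0; 0, -ξ] (IsCMField.complexConj_ne_one L) w hw g :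
              ↥(unitaryGroupOfForm (galAdicCompletionMap (L := L) (IsCMField.complexConj L) hw) (placeForm !![(1 : L), 0; 0, -ξ] w.1))) :
            GL (Fin 2) (w.1.adicCompletion L)) : Matrix (Fin 2) (Fin 2) (w.1.adicCompletion L)).det = 1)
        (T Tn : Subgroup (w.1.adicCompletion L)ˣ)
        (hT : ∀ t : (w.1.adicCompletion L)ˣ, t ∈ T ↔ galAdicCompletionMap (L := L) (IsCMField.complexConj L) hw (t : w.1.adicCompletion L) * t = 1)
        (hTn : ∀ t : (w.1.adicCompletion L)ˣ, t ∈ Tn ↔ galAdicCompletionMap (L := L) (IsCMField.complexConj L) hw (t : w.1.adicCompletion L) * t = 1 ∧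
          Valued.v ((t : w.1.adicCompletion L) - 1) ≤ Valued.v (((2 : LocalRing L v) * ((resChar L v : ℕ) : LocalRing L v)) w)),
        (levelOf L 2 !![(1 : L), 0; 0, -ξ] v 1 (ballMat L 2 v ((resChar L v : ℕ) : LocalRing L v))
              (ballMat_mul_closed L 2 v (mem_localIntegers_of_forall_valued_lt_one L v ha))).relIndex
            (Subgroup.centralizer ({(1 : (cmDatum L 2 !![(1 : L), 0; 0, -ξ]).Local v)} : Set _)) =
          (levelOf L 2 !![(1 : L), 0; 0, -ξ] v 1 (ballMat L 2 v ((resChar L v : ℕ) : LocalRing L v))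
              (ballMat_mul_closed L 2 v (mem_localIntegers_of_forall_valued_lt_one L v ha)) ⊓ S).relIndex S * Tn.relIndex T)
    (hTop :
      ∀ (L : Type) [Field L] [NumberField L] [IsCMField L] (v : HeightOneSpectrum (𝓞 ↥(maximalRealSubfield L)))
        (w : UnitaryGroup.PlacesOver L v) (hw : IsCMField.complexConj L • w.1 = w.1),
        v.asIdeal.ramificationIdx' w.1.asIdeal ≠ 1 → (2 : 𝓞 ↥(maximalRealSubfield L)) ∈ v.asIdeal →
        ∀ (d : ℕ), (∀ τ : w.1.adicCompletion L, Valued.v τ = WithZero.exp (-1 : ℤ) →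
          Valued.v (galAdicCompletionMap (L := L) (IsCMField.complexConj L) hw τ - τ) = WithZero.exp (-(d : ℤ))) →
        ∀ (ξ : L), IsCMField.complexConj L ξ = ξ → Valued.v (algebraMap L (w.1.adicCompletion L) ξ) = 1 →
        (¬ ∃ t : w.1.adicCompletion L, t * galAdicCompletionMap (L := L) (IsCMField.complexConj L) hw t = algebraMap L (w.1.adicCompletion L) ξ) →
        ∀ (S : Subgroup ((UnitaryGroup.cmDatum L 2 !![(1 : L), 0; 0, -ξ]).Local v)),
        (∀ g : (UnitaryGroup.cmDatum L 2 !![(1 : L), 0; 0, -ξ]).Local v, g ∈ S ↔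
          (((localNonsplitEquiv (IsCMField.complexConj L) !![(1 : L), 0; 0, -ξ] (IsCMField.complexConj_ne_one L) w hw g :
              ↥(unitaryGroupOfForm (galAdicCompletionMap (L := L) (IsCMField.complexConj L) hw) (placeForm !![(1 : L), 0; 0, -ξ] w.1))) :
            GL (Fin 2) (w.1.adicCompletion L)) : Matrix (Fin 2) (Fin 2) (w.1.adicCompletion L)).det = 1) →
        (S ⊓ cmLocalIntegralLevel L 2 !![(1 : L), 0; 0, -ξ] v).relIndex S =
          (Nat.card (𝓞 ↥(maximalRealSubfield L) ⧸ v.asIdeal) + 1) * Nat.card (𝓞 ↥(maximalRealSubfield L) ⧸ v.asIdeal) ^ (d - 2))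
    (hLad :
      ∀ (L : Type) [Field L] [NumberField L] [IsCMField L] (v : HeightOneSpectrum (𝓞 ↥(maximalRealSubfield L)))
        (w : UnitaryGroup.PlacesOver L v) (hw : IsCMField.complexConj L • w.1 = w.1),
        v.asIdeal.ramificationIdx' w.1.asIdeal ≠ 1 → (2 : 𝓞 ↥(maximalRealSubfield L)) ∈ v.asIdeal →
        ∀ (m d : ℕ), Valued.v (2 : v.adicCompletion ↥(maximalRealSubfield L)) = WithZero.exp (-(m : ℤ)) →
        (∀ τ : w.1.adicCompletion L, Valued.v τ = WithZero.exp (-1 : ℤ) →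
          Valued.v (galAdicCompletionMap (L := L) (IsCMField.complexConj L) hw τ - τ) = WithZero.exp (-(d : ℤ))) →
        ∀ (ξ : L), IsCMField.complexConj L ξ = ξ → Valued.v (algebraMap L (w.1.adicCompletion L) ξ) = 1 →
        (¬ ∃ t : w.1.adicCompletion L, t * galAdicCompletionMap (L := L) (IsCMField.complexConj L) hw t = algebraMap L (w.1.adicCompletion L) ξ) →
        ∀ (ha : ∀ w' : UnitaryGroup.PlacesOver L v, Valued.v (((resChar L v : ℕ) : UnitaryGroup.LocalRing L v) w') < 1)
          (S : Subgroup ((UnitaryGroup.cmDatum L 2 !![(1 : L), 0; 0, -ξ]).Local v)),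
        (∀ g : (UnitaryGroup.cmDatum L 2 !![(1 : L), 0; 0, -ξ]).Local v, g ∈ S ↔
          (((localNonsplitEquiv (IsCMField.complexConj L) !![(1 : L), 0; 0, -ξ] (IsCMField.complexConj_ne_one L) w hw g :
              ↥(unitaryGroupOfForm (galAdicCompletionMap (L := L) (IsCMField.complexConj L) hw) (placeForm !![(1 : L), 0; 0, -ξ] w.1))) :
            GL (Fin 2) (w.1.adicCompletion L)) : Matrix (Fin 2) (Fin 2) (w.1.adicCompletion L)).det = 1) →
        (levelOf L 2 !![(1 : L), 0; 0, -ξ] v 1 (ballMat L 2 v ((resChar L v : ℕ) : UnitaryGroup.LocalRing L v))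
                (ballMat_mul_closed L 2 v (mem_localIntegers_of_forall_valued_lt_one L v ha)) ⊓ S).relIndex
              (S ⊓ cmLocalIntegralLevel L 2 !![(1 : L), 0; 0, -ξ] v) =
          Nat.card (𝓞 ↥(maximalRealSubfield L) ⧸ v.asIdeal) ^ (6 * m - d / 2)) :

    ∀ (L : Type) [Field L] [NumberField L] [IsCMField L] (v : HeightOneSpectrum (𝓞 ↥(maximalRealSubfield L)))
      (w : UnitaryGroup.PlacesOver L v) (hw : IsCMField.complexConj L • w.1 = w.1),
      (2 : 𝓞 ↥(maximalRealSubfield L)) ∈ v.asIdeal → ¬ Algebra.IsUnramifiedIn (𝓞 L) v.asIdeal →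
      ∀ (m : ℕ), Valued.v (2 : v.adicCompletion ↥(maximalRealSubfield L)) = WithZero.exp (-(m : ℤ)) →
      ∀ (ξ : L), IsCMField.complexConj L ξ = ξ → Valued.v (algebraMap L (w.1.adicCompletion L) ξ) = 1 →
      (¬ ∃ t : w.1.adicCompletion L, t * galAdicCompletionMap (L := L) (IsCMField.complexConj L) hw t = algebraMap L (w.1.adicCompletion L) ξ) →
      ∀ (ha : ∀ w' : UnitaryGroup.PlacesOver L v, Valued.v (((resChar L v : ℕ) : UnitaryGroup.LocalRing L v) w') < 1)
        (α : (w.1.adicCompletion L)ˣ), galAdicCompletionMap (L := L) (IsCMField.complexConj L) hw (α : w.1.adicCompletion L) = -(α : w.1.adicCompletion L) →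
      (Valued.v (α : w.1.adicCompletion L) = WithZero.exp (-1 : ℤ) →
        (levelOf L 2 !![(1 : L), 0; 0, -ξ] v 1 (ballMat L 2 v ((resChar L v : ℕ) : UnitaryGroup.LocalRing L v))
                (ballMat_mul_closed L 2 v (mem_localIntegers_of_forall_valued_lt_one L v ha))).relIndex
              (Subgroup.centralizer ({(1 : (UnitaryGroup.cmDatum L 2 !![(1 : L), 0; 0, -ξ]).Local v)} : Set _)) =
          2 * (Nat.card (𝓞 ↥(maximalRealSubfield L) ⧸ v.asIdeal) + 1) * Nat.card (𝓞 ↥(maximalRealSubfield L) ⧸ v.asIdeal) ^ (8 * m - 1)) ∧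
      (Valued.v (α : w.1.adicCompletion L) = 1 →
        (levelOf L 2 !![(1 : L), 0; 0, -ξ] v 1 (ballMat L 2 v ((resChar L v : ℕ) : UnitaryGroup.LocalRing L v))
                (ballMat_mul_closed L 2 v (mem_localIntegers_of_forall_valued_lt_one L v ha))).relIndex
              (Subgroup.centralizer ({(1 : (UnitaryGroup.cmDatum L 2 !![(1 : L), 0; 0, -ξ]).Local v)} : Set _)) =
          2 * (Nat.card (𝓞 ↥(maximalRealSubfield L) ⧸ v.asIdeal) + 1) * Nat.card (𝓞 ↥(maximalRealSubfield L) ⧸ v.asIdeal) ^ (8 * m - 2)) := by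
  intro L _ _ _ v w hw h2v hram m hm ξ hξc hξ1 hξnn ha α hα
  classical
  have hc1 : IsCMField.complexConj L ≠ 1 := IsCMField.complexConj_ne_one L
  have he : v.asIdeal.ramificationIdx' w.1.asIdeal ≠ 1 := fun h1 =>
    hram (Literature.NumberTheory.Automorphic.Liu2021.LemD1IndexedNonVacuityTameSynthesis.isUnramifiedIn_of_ramificationIdx'_eq_one L (IsCMField.complexConj L) v hc1 w hw h1)
  -- `m ≥ 1` (`2 ∈ v`)
  have hm1 : 1 ≤ m := by
    have h2lt : Valued.v (2 : v.adicCompletion ↥(maximalRealSubfield L)) < 1 := by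
      have h := valued_natCast_lt_one_of_mem ↥(maximalRealSubfield L) v (ℓ := 2) (by exact_mod_cast h2v)
      exact_mod_cast h
    rw [hm, ← WithZero.exp_zero, WithZero.exp_lt_exp] at h2lt
    omega
  -- the residue field of `L⁺_v` is `𝓞 L⁺ ∕ v`
  have hq := natCard_residueField_valuativeRel_eq (K := ↥(maximalRealSubfield L)) v
  -- `|2|_w = q_w^{−2m}`, `|4|_w = q_w^{−4m}`
  have h2w : Valued.v (2 : w.1.adicCompletion L) = WithZero.exp (-(2 * (m : ℤ))) := by
    rw [← map_ofNat (toPlace v w) 2, valued_toPlace_eq_sq_of_ramified L v w hw he, hm, ← WithZero.exp_nsmul]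
    congr 1; rw [nsmul_eq_mul]; push_cast; ring
  have h4w := K2E3WildPlaneTorusCount.valued_four_eq L v w hw he hm
  -- `resChar v = 2`
  have hres : resChar L v = 2 := by
    haveI : Nontrivial (𝓞 ↥(maximalRealSubfield L) ⧸ v.asIdeal) := Ideal.Quotient.nontrivial_iff.2 v.isPrime.ne_top
    have h0 : ((2 : ℕ) : 𝓞 ↥(maximalRealSubfield L) ⧸ v.asIdeal) = 0 := by
      have h := (Ideal.Quotient.eq_zero_iff_mem (I := v.asIdeal) (a := (2 : 𝓞 ↥(maximalRealSubfield L)))).2 h2v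
      rwa [map_ofNat, ← Nat.cast_ofNat] at h
    have hdvd : ringChar (𝓞 ↥(maximalRealSubfield L) ⧸ v.asIdeal) ∣ 2 := (ringChar.spec _ 2).1 h0
    rcases (Nat.dvd_prime Nat.prime_two).1 hdvd with h1 | h2
    · exact absurd h1 (CharP.ringChar_ne_one (R := 𝓞 ↥(maximalRealSubfield L) ⧸ v.asIdeal))
    · exact h2
  have hlev : Valued.v (((2 : LocalRing L v) * ((resChar L v : ℕ) : LocalRing L v)) w) = WithZero.exp (-(4 * (m : ℤ))) := by
    have e : ((2 : LocalRing L v) * ((resChar L v : ℕ) : LocalRing L v)) w = (2 : w.1.adicCompletion L) * ((resChar L v : ℕ) : w.1.adicCompletion L) := rfl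
    rw [e, hres, Nat.cast_ofNat, show (2 : w.1.adicCompletion L) * 2 = 4 by norm_num, h4w]
  -- the determinant-one subgroup `S := ker (det ∘ E_w)`
  set E := localNonsplitEquiv (IsCMField.complexConj L) !![(1 : L), 0; 0, -ξ] hc1 w hw with hEdef
  set δ : (cmDatum L 2 !![(1 : L), 0; 0, -ξ]).Local v →* (w.1.adicCompletion L)ˣ :=
    Matrix.GeneralLinearGroup.det.comp
      ((unitaryGroupOfForm (galAdicCompletionMap (L := L) (IsCMField.complexConj L) hw) (placeForm !![(1 : L), 0; 0, -ξ] w.1)).subtype.comp E.toMonoidHom) with hδdef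
  set S : Subgroup ((cmDatum L 2 !![(1 : L), 0; 0, -ξ]).Local v) := δ.ker with hSdef
  have hSmem : ∀ g : (cmDatum L 2 !![(1 : L), 0; 0, -ξ]).Local v, g ∈ S ↔
      (((E g : ↥(unitaryGroupOfForm (galAdicCompletionMap (L := L) (IsCMField.complexConj L) hw) (placeForm !![(1 : L), 0; 0, -ξ] w.1))) :
        GL (Fin 2) (w.1.adicCompletion L)) : Matrix (Fin 2) (Fin 2) (w.1.adicCompletion L)).det = 1 := by
    intro g
    rw [hSdef, MonoidHom.mem_ker, ← Units.val_eq_one, hδdef]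
    rfl
  -- the norm-one torus `T` and its level `T_n` (`|t − 1|_w ≤ |2·resChar|_w = q_w^{−4m}`)
  obtain ⟨T, hT⟩ := exists_subgroup_normOne L v w hw
  obtain ⟨Tn, hTn⟩ := exists_subgroup_normOne_depth L v w hw (Valued.v (((2 : LocalRing L v) * ((resChar L v : ℕ) : LocalRing L v)) w))
  have hTn' : ∀ t : (w.1.adicCompletion L)ˣ, t ∈ Tn ↔ galAdicCompletionMap (L := L) (IsCMField.complexConj L) hw (t : w.1.adicCompletion L) * t = 1 ∧
      Valued.v ((t : w.1.adicCompletion L) - 1) ≤ WithZero.exp (-(4 * (m : ℤ))) := fun t => by rw [hTn, hlev]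
  -- (C2-struct): `N_an = [S : S ∩ K(4)] · [T : T_n]`
  have hN := hS L v w hw hξ1 ha S hSmem T Tn hT hTn
  -- the different number `d` and the type dictionary
  obtain ⟨d, hd1, hd, -, -, -, hunif, hunit⟩ := exists_different_of_ramified L v w hw he
  -- `K(4) ∩ S ≤ S ∩ K_an ≤ S` and the split `[S : S ∩ K(4)] = [S ∩ K_an : S ∩ K(4)] · [S : S ∩ K_an]`
  have hK4 := levelOf_ballMat_le_inf_level L 2 !![(1 : L), 0; 0, -ξ] v 1 (mem_localIntegers_of_forall_valued_lt_one L v ha)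
  have hle : levelOf L 2 !![(1 : L), 0; 0, -ξ] v 1 (ballMat L 2 v ((resChar L v : ℕ) : LocalRing L v))
        (ballMat_mul_closed L 2 v (mem_localIntegers_of_forall_valued_lt_one L v ha)) ⊓ S ≤
      S ⊓ cmLocalIntegralLevel L 2 !![(1 : L), 0; 0, -ξ] v :=
    fun g hg => Subgroup.mem_inf.2 ⟨(Subgroup.mem_inf.1 hg).2, (Subgroup.mem_inf.1 (hK4 (Subgroup.mem_inf.1 hg).1)).2⟩
  have hsplit := (Subgroup.relIndex_mul_relIndex _ _ S hle inf_le_left).symm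
  have hTop' := hTop L v w hw he h2v d hd ξ hξc hξ1 hξnn S hSmem
  have hLad' := hLad L v w hw he h2v m d hm hd ξ hξc hξ1 hξnn ha S hSmem
  obtain ⟨m', rfl⟩ : ∃ m', m = m' + 1 := ⟨m - 1, by omega⟩
  refine ⟨fun hvα => ?_, fun hvα => ?_⟩
  · -- type √π: an anti-fixed UNIFORMISER ⇒ `q_w^{−d} = |2|_w · q_w⁻¹`, i.e. `d = 2m + 1`
    have hdeq := hunif.1 ⟨(α : w.1.adicCompletion L), hvα, hα⟩
    rw [h2w, ← WithZero.exp_add] at hdeq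
    have hdm : d = 2 * (m' + 1) + 1 := by
      have h := WithZero.exp_injective hdeq
      omega
    have htor := K2E3WildPlaneTorusCount.relIndex_normOne_depth_four_mul_eq_of_odd L v w hw he hvα (hd _ hvα) hdm (by omega) T Tn hT hTn'
    rw [hN, hsplit, hLad', hTop', htor, hq, hdm]
    have e1 : 6 * (m' + 1) - (2 * (m' + 1) + 1) / 2 = 5 * m' + 5 := by omega
    have e2 : 2 * (m' + 1) + 1 - 2 = 2 * m' + 1 := by omega
    have e3 : 8 * (m' + 1) - 1 = 8 * m' + 7 := by omega
    rw [e1, e2, e3]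
    ring
  · -- type √u: an anti-fixed UNIT ⇒ `|2|_w · q_w⁻¹ < q_w^{−d}` (so `d ≤ 2m`) and `d` is EVEN (the anti-fixed `σ_wτ − τ ≠ 0` has even order)
    have hlt := hunit.1 ⟨(α : w.1.adicCompletion L), hvα, hα⟩
    rw [h2w, ← WithZero.exp_add, WithZero.exp_lt_exp] at hlt
    obtain ⟨τ, hτ⟩ := exists_valued_eq_exp_neg_one L v w
    have hy0 : galAdicCompletionMap (L := L) (IsCMField.complexConj L) hw τ - τ ≠ 0 :=
      (Valuation.ne_zero_iff _).1 (valued_galAdicCompletionMap_sub_self_ne_zero L v w hw he hτ)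
    have hσσ : galAdicCompletionMap (L := L) (IsCMField.complexConj L) hw (galAdicCompletionMap (L := L) (IsCMField.complexConj L) hw τ) = τ :=
      galAdicCompletionMap_galAdicCompletionMap_of_smul_eq (IsCMField.complexConj L) w hc1 hw τ
    have hσy : galAdicCompletionMap (L := L) (IsCMField.complexConj L) hw (galAdicCompletionMap (L := L) (IsCMField.complexConj L) hw τ - τ) =
        -(galAdicCompletionMap (L := L) (IsCMField.complexConj L) hw τ - τ) := by
      rw [map_sub, hσσ]; ring
    have hev := Literature.NumberTheory.LocalFields.RamifiedPlaceAntiFixedUnitParity.even_log_valued_of_complexConj_eq_neg_of_unit L w hw he hvα hα hy0 hσy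
    rw [hd τ hτ, WithZero.log_exp, even_neg, Int.even_coe_nat] at hev
    obtain ⟨k, hk⟩ := hev
    have hdk : d = 2 * k := by omega
    have htor := K2E3WildPlaneTorusCount.relIndex_normOne_depth_four_mul_eq_of_even L v w hw he hτ (hd τ hτ) hdk (by omega) (by omega) T Tn hT hTn'
    rw [hN, hsplit, hLad', hTop', htor, hq, hdk]
    obtain ⟨k', rfl⟩ : ∃ k', k = k' + 1 := ⟨k - 1, by omega⟩
    have e1 : 6 * (m' + 1) - 2 * (k' + 1) / 2 = 6 * m' + 5 - k' := by omega
    have e2 : 2 * (k' + 1) - 2 = 2 * k' := by omega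
    have e3 : 2 * (m' + 1) - (k' + 1) = 2 * m' + 1 - k' := by omega
    have e4 : 8 * (m' + 1) - 2 = 8 * m' + 6 := by omega
    rw [e1, e2, e3, e4]
    obtain ⟨r, hr⟩ : ∃ r, m' = k' + r := ⟨m' - k', by omega⟩
    subst hr
    have e5 : 6 * (k' + r) + 5 - k' = 5 * k' + 6 * r + 5 := by omega
    have e6 : 2 * (k' + r) + 1 - k' = k' + 2 * r + 1 := by omega
    rw [e5, e6]
    ring

end Summit.HodgeConjecture.HodgeConjecture.Cruxes.H413.K2E3WildAnisotropicResidualCountOfParts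

end
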